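import Mathlib.LinearAlgebra.Span.Basic
import Mathlib.LinearAlgebra.Dimension.Finrank
import Mathlib.LinearAlgebra.FiniteDimensional.Defs
import Literature.Computability.AlgebraicComplexity.FlipGraphConnectivity
import HarnessLib

/-!
# The factors of a matrix multiplication scheme span the whole matrix space
# (Arai–Ichikawa–Hukushima 2024, Lemma 5.1)

Topic `Literature/Computability/AlgebraicComplexity`, in the tree's coordinates
(`MatrixMultiplicationExponent.lean`: `triad w u v = w ⊗ u ⊗ v`, `matMulTensor K k m n = ⟨k,m,n⟩`
with slots `(Z_{κν}, X_{κμ}, Y_{μν})`; `FlipGraphConnectivity.lean`: `FlipGraph.Scheme`, KM Def. 1).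
Source: Y. Arai, Y. Ichikawa, K. Hukushima, *Adaptive Flip Graph Algorithm for Matrix
Multiplication*, ISSAC 2024 = arXiv:2312.16960 (AIH), §5, Lemma 5.1: "In the `(n,m,p)`-matrix
multiplication scheme `S`, it holds that `rank([α^{(1)}, α^{(2)}, …, α^{(R)}]) = n*m`. Similarly,
for `β` and `γ`, `rank([β^{(1)}, …, β^{(R)}]) = m*p` and `rank([γ^{(1)}, …, γ^{(R)}]) = p*n`."
(the `α`, `β`, `γ` being the coefficient vectors of the `A`-, `B`- and `C`-forms of the `R`
rank-one elements of the scheme), with the printed proof: "for any `i, k`, `a_{i,k}` can be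
expressed as a linear combination of the vectors `α^{(r)}`". This is the lemma behind the
connectivity of the flip graph with plus transitions (AIH Thm. 5.2: "`α'` is limited to those `α`
existing within the scheme `S`"). Everything here is PROVED over an arbitrary commutative ring
(the rank statements over a field); no named facts.

## What is typed

* `dslice₁_mem_span`, `dslice₂_mem_span`, `dslice₃_mem_span` — for `t = ∑_ρ w_ρ ⊗ u_ρ ⊗ v_ρ`, every
  "double slice" `t(·, b, c)` (resp. `t(a, ·, c)`, `t(a, b, ·)`) is a linear combination of the
  `w_ρ` (resp. `u_ρ`, `v_ρ`) — the computation of the printed proof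
  ("`a_{i,k} = Σ_r β^{(r)}_{k,j} γ^{(r)}_{j,i} α^{(r)}`").
* `araiIchikawaHukushima2024_lem51_X/Y/Z` — **AIH Lemma 5.1** for a decomposition
  `⟨k,m,n⟩ = ∑_ρ w_ρ ⊗ u_ρ ⊗ v_ρ` indexed by any finite type: the `X`-factors `u_ρ ∈ K^{k×m}` span
  `K^{k×m}` (AIH's `α`), the `Y`-factors span `K^{m×n}` (AIH's `β`), the `Z`-factors span `K^{k×n}`
  (AIH's `γ`, transposed); `…_finrank_X/Y/Z` — the printed form "`rank = n·m`" etc. (over a field);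
  `araiIchikawaHukushima2024_lem51_scheme_X/Y/Z` — the same for a scheme in the sense of KM Def. 1 /
  AIH Def. 2.4 (`FlipGraph.Scheme`, a multiset of rank-one tensors): the set of `X`-factors of
  its elements spans `K^{k×m}`, etc.

Faithfulness / scope note. The printed lemma carries no hypothesis on the format; it needs the
third dimension to be non-zero (for `(n,m,0)` the tensor is `0`, the empty scheme is a scheme, and
`rank([]) = 0 ≠ n·m`): the `X`-statement is proved for `0 < n` (tree's third index), the
`Y`-statement for `0 < k`, the `Z`-statement for `0 < m`, which is exactly what the printed proof
uses (it fixes an index `j` of the missing dimension).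

## References

* Y. Arai, Y. Ichikawa, K. Hukushima, *Adaptive Flip Graph Algorithm for Matrix Multiplication*,
  Proc. ISSAC 2024, 292–298, doi:10.1145/3666000.3669701, arXiv:2312.16960 — §5, Lemma 5.1 and
  its proof; Def. 2.4 (schemes as multisets). [AraiIchikawaHukushima2024]
* M. Kauers, J. Moosbauer, *Flip Graphs for Matrix Multiplication*, ISSAC 2023, arXiv:2212.01175,
  Def. 1 (schemes). [KauersMoosbauer2022FlipGraphs]
* M. Bläser, *Fast Matrix Multiplication*, Theory of Computing Graduate Surveys 5 (2013), §5
  (the tensor `⟨k,m,n⟩`). [Blaser2013]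
-/

namespace Literature.Computability.AlgebraicComplexity

open scoped BigOperators
open Submodule

/-! ## Double slices of a sum of triads -/

section Slices

variable {K : Type*} [CommRing K] {ι κ μ σ : Type*} [Fintype σ]

/-- `(∑_ρ w_ρ ⊗ u_ρ ⊗ v_ρ)(·, b, c) = ∑_ρ (u_ρ(b) v_ρ(c)) · w_ρ`.
[cite: AraiIchikawaHukushima2024, Lemma 5.1 (proof)] -/
theorem dslice₁_eq_sum (w : σ → ι → K) (u : σ → κ → K) (v : σ → μ → K) (b : κ) (c : μ) :
    (fun a => (∑ ρ, triad (w ρ) (u ρ) (v ρ)) a b c) = ∑ ρ, (u ρ b * v ρ c) • w ρ := by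
  funext a
  simp only [Finset.sum_apply, triad_apply, Pi.smul_apply, smul_eq_mul]
  exact Finset.sum_congr rfl fun ρ _ => by ring

/-- `(∑_ρ w_ρ ⊗ u_ρ ⊗ v_ρ)(a, ·, c) = ∑_ρ (w_ρ(a) v_ρ(c)) · u_ρ` — printed: "`a_{i,k} = Σ_r β^{(r)}_{k,j}
γ^{(r)}_{j,i} α^{(r)}`". [cite: AraiIchikawaHukushima2024, Lemma 5.1 (proof)] -/
theorem dslice₂_eq_sum (w : σ → ι → K) (u : σ → κ → K) (v : σ → μ → K) (a : ι) (c : μ) :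
    (fun b => (∑ ρ, triad (w ρ) (u ρ) (v ρ)) a b c) = ∑ ρ, (w ρ a * v ρ c) • u ρ := by
  funext b
  simp only [Finset.sum_apply, triad_apply, Pi.smul_apply, smul_eq_mul]
  exact Finset.sum_congr rfl fun ρ _ => by ring

/-- `(∑_ρ w_ρ ⊗ u_ρ ⊗ v_ρ)(a, b, ·) = ∑_ρ (w_ρ(a) u_ρ(b)) · v_ρ`.
[cite: AraiIchikawaHukushima2024, Lemma 5.1 (proof)] -/
theorem dslice₃_eq_sum (w : σ → ι → K) (u : σ → κ → K) (v : σ → μ → K) (a : ι) (b : κ) :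
    (fun c => (∑ ρ, triad (w ρ) (u ρ) (v ρ)) a b c) = ∑ ρ, (w ρ a * u ρ b) • v ρ := by
  funext c
  simp only [Finset.sum_apply, triad_apply, Pi.smul_apply, smul_eq_mul]

variable {t : ι → κ → μ → K} {w : σ → ι → K} {u : σ → κ → K} {v : σ → μ → K}

/-- Every double slice `t(·, b, c)` of `t = ∑_ρ w_ρ ⊗ u_ρ ⊗ v_ρ` lies in the span of the first
factors. [cite: AraiIchikawaHukushima2024, Lemma 5.1 (proof)] -/
theorem dslice₁_mem_span (ht : t = ∑ ρ, triad (w ρ) (u ρ) (v ρ)) (b : κ) (c : μ) :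
    (fun a => t a b c) ∈ span K (Set.range w) := by
  rw [ht, dslice₁_eq_sum]
  exact sum_mem fun ρ _ => smul_mem _ _ (subset_span ⟨ρ, rfl⟩)

/-- Every double slice `t(a, ·, c)` lies in the span of the second factors.
[cite: AraiIchikawaHukushima2024, Lemma 5.1 (proof)] -/
theorem dslice₂_mem_span (ht : t = ∑ ρ, triad (w ρ) (u ρ) (v ρ)) (a : ι) (c : μ) :
    (fun b => t a b c) ∈ span K (Set.range u) := by
  rw [ht, dslice₂_eq_sum]
  exact sum_mem fun ρ _ => smul_mem _ _ (subset_span ⟨ρ, rfl⟩)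

/-- Every double slice `t(a, b, ·)` lies in the span of the third factors.
[cite: AraiIchikawaHukushima2024, Lemma 5.1 (proof)] -/
theorem dslice₃_mem_span (ht : t = ∑ ρ, triad (w ρ) (u ρ) (v ρ)) (a : ι) (b : κ) :
    (fun c => t a b c) ∈ span K (Set.range v) := by
  rw [ht, dslice₃_eq_sum]
  exact sum_mem fun ρ _ => smul_mem _ _ (subset_span ⟨ρ, rfl⟩)

/-- A submodule of `K^ν` (`ν` finite) containing every basis vector `e_i` is everything.
[folklore] -/
private theorem pi_submodule_eq_top_of_single_mem {ν : Type*} [Fintype ν] [DecidableEq ν]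
    (M : Submodule K (ν → K)) (h : ∀ i, Pi.single i (1 : K) ∈ M) : M = ⊤ := by
  refine eq_top_iff'.2 fun f => ?_
  rw [pi_eq_sum_univ f]
  refine sum_mem fun i _ => smul_mem _ _ ?_
  have e : (fun j => if i = j then (1 : K) else 0) = Pi.single i (1 : K) := by
    funext j
    by_cases hij : i = j
    · subst hij; simp
    · rw [if_neg hij, Pi.single_eq_of_ne (Ne.symm hij)]
  rw [e]
  exact h i

end Slices

/-! ## AIH Lemma 5.1 for `⟨k,m,n⟩` -/

section MatMul

variable {K : Type*} [CommRing K] {k m n : ℕ} {σ : Type*} [Fintype σ]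
  {w : σ → Fin k × Fin n → K} {u : σ → Fin k × Fin m → K} {v : σ → Fin m × Fin n → K}

/-- The double slices of `⟨k,m,n⟩` in the `X`-slot are the basis vectors:
`⟨k,m,n⟩((κ,ν), ·, (μ,ν)) = e_{κμ}`. [cite: Blaser2013, §5] -/
theorem matMulTensor_dslice₂ (κ : Fin k) (μ : Fin m) (ν : Fin n) :
    (fun b => matMulTensor K k m n (κ, ν) b (μ, ν)) = Pi.single (κ, μ) 1 := by
  funext b
  obtain ⟨b₁, b₂⟩ := b
  by_cases h : (b₁, b₂) = (κ, μ)
  · obtain ⟨rfl, rfl⟩ := Prod.mk.inj h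
    simp [matMulTensor]
  · rw [Pi.single_eq_of_ne h]
    simp only [matMulTensor]
    rw [if_neg]
    rintro ⟨h1, h2, -⟩
    exact h (Prod.ext h1.symm h2)

/-- The double slices of `⟨k,m,n⟩` in the `Y`-slot: `⟨k,m,n⟩((κ,ν), (κ,μ), ·) = e_{μν}`.
[cite: Blaser2013, §5] -/
theorem matMulTensor_dslice₃ (κ : Fin k) (μ : Fin m) (ν : Fin n) :
    (fun c => matMulTensor K k m n (κ, ν) (κ, μ) c) = Pi.single (μ, ν) 1 := by
  funext c
  obtain ⟨c₁, c₂⟩ := c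
  by_cases h : (c₁, c₂) = (μ, ν)
  · obtain ⟨rfl, rfl⟩ := Prod.mk.inj h
    simp [matMulTensor]
  · rw [Pi.single_eq_of_ne h]
    simp only [matMulTensor]
    rw [if_neg]
    rintro ⟨-, h2, h3⟩
    exact h (Prod.ext h2.symm h3.symm)

/-- The double slices of `⟨k,m,n⟩` in the `Z`-slot: `⟨k,m,n⟩(·, (κ,μ), (μ,ν)) = e_{κν}`.
[cite: Blaser2013, §5] -/
theorem matMulTensor_dslice₁ (κ : Fin k) (μ : Fin m) (ν : Fin n) :
    (fun a => matMulTensor K k m n a (κ, μ) (μ, ν)) = Pi.single (κ, ν) 1 := by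
  funext a
  obtain ⟨a₁, a₂⟩ := a
  by_cases h : (a₁, a₂) = (κ, ν)
  · obtain ⟨rfl, rfl⟩ := Prod.mk.inj h
    simp [matMulTensor]
  · rw [Pi.single_eq_of_ne h]
    simp only [matMulTensor]
    rw [if_neg]
    rintro ⟨h1, -, h3⟩
    exact h (Prod.ext h1 h3)

/-- **AIH Lemma 5.1 (`α`):** in any decomposition `⟨k,m,n⟩ = ∑_ρ w_ρ ⊗ u_ρ ⊗ v_ρ` the `X`-factors
`u_ρ` ("the vectors `α^{(r)}`") span `K^{k×m}` — printed "`rank([α^{(1)}, …, α^{(R)}]) = n*m`",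
proof: "for any `i, k`, `a_{i,k}` can be expressed as a linear combination of the vectors
`α^{(r)}`". Needs `0 < n` (a column index to slice at).
[cite: AraiIchikawaHukushima2024, Lemma 5.1] -/
theorem araiIchikawaHukushima2024_lem51_X (hn : 0 < n)
    (ht : matMulTensor K k m n = ∑ ρ, triad (w ρ) (u ρ) (v ρ)) :
    span K (Set.range u) = ⊤ := by
  refine pi_submodule_eq_top_of_single_mem _ fun p => ?_
  obtain ⟨κ, μ⟩ := p
  have h := dslice₂_mem_span ht (κ, (⟨0, hn⟩ : Fin n)) (μ, ⟨0, hn⟩)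
  rwa [matMulTensor_dslice₂] at h

/-- **AIH Lemma 5.1 (`β`):** the `Y`-factors `v_ρ` span `K^{m×n}` ("`rank([β^{(1)}, …, β^{(R)}]) =
m*p`"). Needs `0 < k`. [cite: AraiIchikawaHukushima2024, Lemma 5.1] -/
theorem araiIchikawaHukushima2024_lem51_Y (hk : 0 < k)
    (ht : matMulTensor K k m n = ∑ ρ, triad (w ρ) (u ρ) (v ρ)) :
    span K (Set.range v) = ⊤ := by
  refine pi_submodule_eq_top_of_single_mem _ fun p => ?_
  obtain ⟨μ, ν⟩ := p
  have h := dslice₃_mem_span ht ((⟨0, hk⟩ : Fin k), ν) (⟨0, hk⟩, μ)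
  rwa [matMulTensor_dslice₃] at h

/-- **AIH Lemma 5.1 (`γ`):** the `Z`-factors `w_ρ` span `K^{k×n}` ("`rank([γ^{(1)}, …, γ^{(R)}]) =
p*n`"; AIH's `γ` is the transpose of the tree's `Z`-slot). Needs `0 < m`.
[cite: AraiIchikawaHukushima2024, Lemma 5.1] -/
theorem araiIchikawaHukushima2024_lem51_Z (hm : 0 < m)
    (ht : matMulTensor K k m n = ∑ ρ, triad (w ρ) (u ρ) (v ρ)) :
    span K (Set.range w) = ⊤ := by
  refine pi_submodule_eq_top_of_single_mem _ fun p => ?_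
  obtain ⟨κ, ν⟩ := p
  have h := dslice₁_mem_span ht (κ, (⟨0, hm⟩ : Fin m)) (⟨0, hm⟩, ν)
  rwa [matMulTensor_dslice₁] at h

end MatMul

/-! ## The printed form: `rank = n·m` (over a field) -/

section Rank

variable {K : Type*} [Field K] {k m n : ℕ} {σ : Type*} [Fintype σ]
  {w : σ → Fin k × Fin n → K} {u : σ → Fin k × Fin m → K} {v : σ → Fin m × Fin n → K}

/-- **AIH Lemma 5.1, printed form (`α`):** "`rank([α^{(1)}, α^{(2)}, …, α^{(R)}]) = n*m`" — the
span of the `X`-factors has dimension `k·m`. [cite: AraiIchikawaHukushima2024, Lemma 5.1] -/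
theorem araiIchikawaHukushima2024_lem51_finrank_X (hn : 0 < n)
    (ht : matMulTensor K k m n = ∑ ρ, triad (w ρ) (u ρ) (v ρ)) :
    Module.finrank K (span K (Set.range u)) = k * m := by
  rw [araiIchikawaHukushima2024_lem51_X hn ht, finrank_top, Module.finrank_fintype_fun_eq_card,
    Fintype.card_prod, Fintype.card_fin, Fintype.card_fin]

/-- **AIH Lemma 5.1, printed form (`β`):** "`rank([β^{(1)}, …, β^{(R)}]) = m*p`".
[cite: AraiIchikawaHukushima2024, Lemma 5.1] -/
theorem araiIchikawaHukushima2024_lem51_finrank_Y (hk : 0 < k)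
    (ht : matMulTensor K k m n = ∑ ρ, triad (w ρ) (u ρ) (v ρ)) :
    Module.finrank K (span K (Set.range v)) = m * n := by
  rw [araiIchikawaHukushima2024_lem51_Y hk ht, finrank_top, Module.finrank_fintype_fun_eq_card,
    Fintype.card_prod, Fintype.card_fin, Fintype.card_fin]

/-- **AIH Lemma 5.1, printed form (`γ`):** "`rank([γ^{(1)}, …, γ^{(R)}]) = p*n`".
[cite: AraiIchikawaHukushima2024, Lemma 5.1] -/
theorem araiIchikawaHukushima2024_lem51_finrank_Z (hm : 0 < m)
    (ht : matMulTensor K k m n = ∑ ρ, triad (w ρ) (u ρ) (v ρ)) :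
    Module.finrank K (span K (Set.range w)) = k * n := by
  rw [araiIchikawaHukushima2024_lem51_Z hm ht, finrank_top, Module.finrank_fintype_fun_eq_card,
    Fintype.card_prod, Fintype.card_fin, Fintype.card_fin]

end Rank

/-! ## The same for schemes in the sense of KM Def. 1 / AIH Def. 2.4 (multisets of rank-one tensors) -/

section Scheme

variable {K : Type*} [Field K] {k m n : ℕ}

open FlipGraph in
/-- A scheme (multiset of rank-one tensors summing to `t`) yields an indexed decomposition whose
factors are factors of its elements. [cite: KauersMoosbauer2022FlipGraphs, Def. 1] -/
theorem FlipGraph.Scheme.exists_fin_eq_sum {ι κ μ : Type*} {t : ι → κ → μ → K} (S : Scheme t) :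
    ∃ (r : ℕ) (w : Fin r → ι → K) (u : Fin r → κ → K) (v : Fin r → μ → K),
      t = ∑ i, triad (w i) (u i) (v i) ∧ ∀ i, triad (w i) (u i) (v i) ∈ S.elts := by
  classical
  choose! fa fb fc hf using S.exists_triad
  obtain ⟨l, hl⟩ := Quotient.exists_rep S.elts
  have hmem : ∀ i : Fin l.length, l.get i ∈ S.elts := fun i => by
    rw [← hl]; exact Multiset.mem_coe.mpr (List.get_mem l i)
  refine ⟨l.length, fun i => fa (l.get i), fun i => fb (l.get i), fun i => fc (l.get i), ?_,
    fun i => ?_⟩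
  · rw [← S.sum_eq, ← hl, Multiset.quot_mk_to_coe, Multiset.sum_coe, ← Fin.sum_univ_getElem]
    exact Finset.sum_congr rfl fun i _ => hf _ (hmem i)
  · rw [← hf _ (hmem i)]
    exact hmem i

open FlipGraph in
/-- **AIH Lemma 5.1 for a scheme (`α`):** the `X`-factors of the elements of any
`(k,m,n)`-scheme span `K^{k×m}` (`0 < n`). [cite: AraiIchikawaHukushima2024, Lemma 5.1 with Def. 2.4] -/
theorem araiIchikawaHukushima2024_lem51_scheme_X (hn : 0 < n)
    (S : Scheme (matMulTensor K k m n)) :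
    span K {x : Fin k × Fin m → K | ∃ T ∈ S.elts, ∃ (z : Fin k × Fin n → K)
      (y : Fin m × Fin n → K), T = triad z x y} = ⊤ := by
  obtain ⟨r, w, u, v, ht, hmem⟩ := S.exists_fin_eq_sum
  refine eq_top_iff.2 ((araiIchikawaHukushima2024_lem51_X hn ht).symm.le.trans (span_mono ?_))
  rintro x ⟨i, rfl⟩
  exact ⟨_, hmem i, w i, v i, rfl⟩

open FlipGraph in
/-- **AIH Lemma 5.1 for a scheme (`β`):** the `Y`-factors span `K^{m×n}` (`0 < k`).
[cite: AraiIchikawaHukushima2024, Lemma 5.1 with Def. 2.4] -/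
theorem araiIchikawaHukushima2024_lem51_scheme_Y (hk : 0 < k)
    (S : Scheme (matMulTensor K k m n)) :
    span K {y : Fin m × Fin n → K | ∃ T ∈ S.elts, ∃ (z : Fin k × Fin n → K)
      (x : Fin k × Fin m → K), T = triad z x y} = ⊤ := by
  obtain ⟨r, w, u, v, ht, hmem⟩ := S.exists_fin_eq_sum
  refine eq_top_iff.2 ((araiIchikawaHukushima2024_lem51_Y hk ht).symm.le.trans (span_mono ?_))
  rintro y ⟨i, rfl⟩
  exact ⟨_, hmem i, w i, u i, rfl⟩

open FlipGraph in
/-- **AIH Lemma 5.1 for a scheme (`γ`):** the `Z`-factors span `K^{k×n}` (`0 < m`).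
[cite: AraiIchikawaHukushima2024, Lemma 5.1 with Def. 2.4] -/
theorem araiIchikawaHukushima2024_lem51_scheme_Z (hm : 0 < m)
    (S : Scheme (matMulTensor K k m n)) :
    span K {z : Fin k × Fin n → K | ∃ T ∈ S.elts, ∃ (x : Fin k × Fin m → K)
      (y : Fin m × Fin n → K), T = triad z x y} = ⊤ := by
  obtain ⟨r, w, u, v, ht, hmem⟩ := S.exists_fin_eq_sum
  refine eq_top_iff.2 ((araiIchikawaHukushima2024_lem51_Z hm ht).symm.le.trans (span_mono ?_))
  rintro z ⟨i, rfl⟩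
  exact ⟨_, hmem i, u i, v i, rfl⟩

end Scheme

end Literature.Computability.AlgebraicComplexity
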